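import Literature.AlgebraicGeometry.HodgeTheory.SymbolClasses
import Literature.AlgebraicGeometry.HodgeTheory.ComplexifiedDeRhamFamily
import Literature.NumberTheory.Transcendental.DeRhamTheoremMultiplicative
import Literature.AlgebraicGeometry.HodgeTheory.LefschetzOneOneHeartOfCechIntegral
import Literature.AlgebraicGeometry.HodgeTheory.LefschetzOneOneCechIntegrality
import Literature.AlgebraicGeometry.HodgeTheory.RationalLatticeIntegral
import Literature.AlgebraicGeometry.HodgeTheory.HodgeFiltrationModelsReductionProofs
import Literature.AlgebraicGeometry.HodgeTheory.ComplexConjugationHolds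
import Literature.Geometry.Kaehler.HolomorphicLineBundleChernConnection
import HarnessLib

/-!
# Stub `stub_weightOneModel` (S1) of line `lefschetz-fold`, crux `SymbolLiftR`

On a smooth projective complex `n`-fold there is a Hodge model `A` whose de Rham comparison is
de Rham's INTEGRATION comparison complexified and rescaled by `(2πi)^{-k/2}` in degree `k`, and on
which every rational class of Hodge type `(1,1)` has a weight-one Milnor symbol cocycle
(`A.HasSymbolCocycle 0 c`): Lefschetz `(1,1)` in symbol form (Voisin I, proof of Thm. 7.10: the
cocycle `(g_ij)` of a holomorphic line bundle, the forms `∂ log h_i` of a Hermitian metric, and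
the Chern form; Griffiths–Harris pp. 141, 148–149).

* `exists_hodgeModel_integrationScaled` — the model (any Hodge model with its comparison replaced
  by the rescaled complexified integration family, natural by
  `integrationDeRhamIsoFamily_isNatural` and `DeRhamIsoFamily.complexify_isNatural`);
* `isTransgression_symbolCochain_zero` — the analytic core: for a Hermitian holomorphic line
  cocycle `(L, h)` with Chern form `θ`, the zig-zag `Z_{0,1} = (-∂ log h_i)_i` transgresses the
  symbol forms `dlog g_ij` of the transition cocycle to `2πi • θ` (gauge law
  `HermitianMetric.dPrime_logWeight_eq`, curvature `mextDeriv_dPrime_apply`);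
* `hasSymbolCocycle_zero_of_integrationScaled` — weight one on an integration-scaled model: an
  integral multiple `N • c` of a rational `(1,1)` class is `e₀[θ_ch]` for the Chern form of a
  Hermitian holomorphic line cocycle on a finite chart-convex cover (the heart of Lefschetz `(1,1)`
  for the integration family, `exists_real_closed_oneOne_rep`, `exists_isChernForm_of_cechIntegral`
  fed `CechCocycleIntegral_holds`), whence `A.deRham [2πi θ_ch] = N • A^* c`.
-/

noncomputable section
open scoped Manifold ContDiff
namespace Summit.HodgeConjecture.HodgeConjecture.Theorems.SymbolLiftR
open Literature.AlgebraicGeometry Literature.AlgebraicGeometry.HodgeTheory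
open Literature.Geometry.Kaehler Literature.NumberTheory.Transcendental

set_option linter.dupNamespace false

open Literature.AlgebraicTopology.SingularHomology (singularCohomology)

/-! ### Part 1: the rescaled-integration Hodge model -/

/-- **A Hodge model whose comparison is the `(2πi)^{-k/2}`-rescaled integration comparison.**
Given any Hodge model `A₀` of `X`, replacing its de Rham comparison by
`((2πi)^{k/2})⁻¹ • ((integrationDeRhamIsoFamily A₀.model) ⊗ ℂ)` (natural:
`integrationDeRhamIsoFamily_isNatural`, `DeRhamIsoFamily.complexify_isNatural`, and the pull-backs
on singular cohomology are `ℂ`-linear) gives a Hodge model with the same analytification and Hodge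
decomposition. [folklore] -/
theorem exists_hodgeModel_integrationScaled {n : ℕ} {X : Motives.SchemeOver ℂ}
    (A₀ : HodgeModel n X) :
    ∃ A : HodgeModel n X, ∀ (k : ℕ) (y : complexDeRhamCohomology A.model A.carrier k),
      A.deRham A.carrier k y = ((2 * (Real.pi : ℂ) * Complex.I) ^ (k / 2))⁻¹ •
        (integrationDeRhamIsoFamily A.model).complexify A.carrier k y := by
  have hs : ∀ k : ℕ, ((2 * (Real.pi : ℂ) * Complex.I) ^ (k / 2))⁻¹ ≠ 0 :=
    fun k ↦ inv_ne_zero (pow_ne_zero _ Complex.two_pi_I_ne_zero)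
  have he : ((integrationDeRhamIsoFamily A₀.model).complexify).IsNatural :=
    DeRhamIsoFamily.complexify_isNatural (integrationDeRhamIsoFamily_isNatural (E := A₀.model))
  refine ⟨{ A₀ with
    deRham := fun M _ _ _ _ _ k ↦ ((integrationDeRhamIsoFamily A₀.model).complexify M k).trans
      (LinearEquiv.smulOfNeZero ℂ _ _ (hs k))
    deRham_isNatural := ?_ }, fun k y ↦ rfl⟩
  intro M N _ _ _ _ _ _ _ _ _ _ _ f hf k c
  change ((2 * (Real.pi : ℂ) * Complex.I) ^ (k / 2))⁻¹ •
      (integrationDeRhamIsoFamily A₀.model).complexify M k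
        (complexDeRhamCohomology.map A₀.model hf k c) =
    singularCohomology.map ℂ ℂ ⟨f, hf.continuous⟩ k
      (((2 * (Real.pi : ℂ) * Complex.I) ^ (k / 2))⁻¹ •
        (integrationDeRhamIsoFamily A₀.model).complexify N k c)
  rw [he M N f hf k c, map_smul]

/-! ### Part 2a: the analytic core — the symbol zig-zag of a Hermitian holomorphic line cocycle -/

/-- **The transition cocycle of a Hermitian holomorphic line bundle transgresses to `2πi` times
its Chern form.** For a holomorphic line bundle `L` presented by a cocycle `(g_ij)` on the cover
`(U_i)`, a Hermitian metric `h = (h_i)` and a `2`-form `θ` which is the Chern form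
`(1/4π) d((d log h_i) ∘ J)` on every `U_i`, the Čech `0`-cochain of `1`-forms
`Z_{0,1} = (-∂ log h_i)_i` is a zig-zag (`IsTransgression`, `q = 0`) from the symbol forms
`dlog g_{J₀J₁} = g_{J₀J₁}⁻¹ dg_{J₀J₁}` of the transition cocycle `L.symbolCochain 0` down to
`2πi • θ`: TOP `(δZ)_{(J₀,J₁)} = ∂ log h_{J₀} - ∂ log h_{J₁} = g_{J₁J₀} dg_{J₀J₁}` by the gauge law
`∂ log h_j = ∂ log h_i + g_ij dg_ji` (`HermitianMetric.dPrime_logWeight_eq`, `g_ij g_ji = 1`);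
BOTTOM `d(-∂ log h_i) = (i/2) d((d log h_i) ∘ J) = 2πi • (1/4π) d((d log h_i) ∘ J)`
(`mextDeriv_dPrime_apply`). This is the computation of `c₁(L)` through the Čech–de Rham double
complex (Voisin I, proof of Thm. 7.10; Griffiths–Harris, p. 141).
[cite: VoisinHodgeI2002, Thm. 7.10 (proof)] -/
theorem isTransgression_symbolCochain_zero {ι : Type*} {E : Type*} [NormedAddCommGroup E]
    [NormedSpace ℂ E] [FiniteDimensional ℂ E] {M : Type*} [TopologicalSpace M] [ChartedSpace E M]
    [IsManifold 𝓘(ℂ, E) ω M] [IsManifold 𝓘(ℝ, E) ∞ M] (L : HolomorphicLineBundle ι E M)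
    (h : L.HermitianMetric) {θ : MForm 𝓘(ℝ, E) M ℂ 2} (hθ : h.IsChernForm θ) :
    IsTransgression L.isOpen_baseSet 0 (fun J ↦ symbolForm E (0 + 1) (L.symbolCochain 0 J))
      ((2 * (Real.pi : ℂ) * Complex.I) • θ) := by
  -- the cochains `α_J = -(∂ log h_{J 0})|_{U_J}` are smooth forms on `U_J`
  have hαmem : ∀ {a : ℕ} (J : Fin (a + 1) → ι),
      (-(dPrime E (h.logWeight (J 0)))).restr (cechSet L.baseSet J) ∈
        smoothFormsOn 𝓘(ℝ, E) ℂ (cechSet L.baseSet J) 1 := fun J ↦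
    ⟨fun x hx ↦ (MForm.smoothAt_restr_iff (isOpen_cechSet L.isOpen_baseSet J) _ hx).2
        (smoothAt_dPrime (h.eventually_smoothAt_ofFun_logWeight
          (cechSet_subset_apply _ J 0 hx))).neg,
      fun x hx ↦ MForm.restr_apply_of_notMem _ hx⟩
  -- the zig-zag: `Z_{a,1} = α` in every Čech degree `a` (only `Z_{0,1}` is constrained)
  obtain ⟨Z, hZ⟩ : ∃ Z : (a b : ℕ) → CechForms 𝓘(ℝ, E) ℂ L.baseSet a b,
      ∀ (a : ℕ) (J : Fin (a + 1) → ι), (Z a 1 J : MForm 𝓘(ℝ, E) M ℂ 1) =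
        (-(dPrime E (h.logWeight (J 0)))).restr (cechSet L.baseSet J) :=
    ⟨fun a b J ↦ Pi.single (M := fun b ↦ ↥(smoothFormsOn 𝓘(ℝ, E) ℂ (cechSet L.baseSet J) b)) 1
      ⟨_, hαmem J⟩ b, fun a J ↦ by simp⟩
  -- TOP: `(δZ)_{(J₀,J₁)} = ∂ log h_{J₀} - ∂ log h_{J₁} = g_{J₀J₁}⁻¹ dg_{J₀J₁}` (gauge law)
  have htop : ∀ (J : Fin (0 + 2) → ι), ∀ x ∈ cechSet L.baseSet J,
      (cechδ 𝓘(ℝ, E) ℂ L.isOpen_baseSet 0 1 (Z 0 1) J : MForm 𝓘(ℝ, E) M ℂ 1) x =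
        symbolForm E (0 + 1) (L.symbolCochain 0 J) x := by
    intro J x hx
    have hx0 : x ∈ L.baseSet (J 0) := cechSet_subset_apply _ J 0 hx
    have hx1 : x ∈ L.baseSet (J 1) := cechSet_subset_apply _ J 1 hx
    have hf0 : (Z 0 1 (J ∘ Fin.succAbove 0) : MForm 𝓘(ℝ, E) M ℂ 1) x =
        -(dPrime E (h.logWeight (J 1)) x) := by
      rw [hZ, MForm.restr_apply_of_mem _ (cechSet_subset_comp L.baseSet J (Fin.succAbove 0) hx)]
      rfl
    have hf1 : (Z 0 1 (J ∘ Fin.succAbove 1) : MForm 𝓘(ℝ, E) M ℂ 1) x =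
        -(dPrime E (h.logWeight (J 0)) x) := by
      rw [hZ, MForm.restr_apply_of_mem _ (cechSet_subset_comp L.baseSet J (Fin.succAbove 1) hx)]
      rfl
    rw [coe_cechδ_apply_apply_of_mem L.isOpen_baseSet _ hx, Fin.sum_univ_two, hf0, hf1]
    simp only [Fin.val_zero, Fin.val_one, pow_zero, pow_one, one_smul, neg_smul, neg_neg]
    rw [h.dPrime_logWeight_eq hx1 hx0, neg_add_cancel_left,
      HolomorphicLineBundle.symbolCochain_apply, symbolForm_single, one_smul]
    ext v
    rw [show dlogWedge E (0 + 1)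
        (fun i : Fin (0 + 1) ↦ L.coordChange (J (Fin.castSucc i)) (J i.succ)) x v = _ from
        dlogWedge_one_apply _ x v, ContinuousAlternatingMap.smul_apply,
      ← inv_eq_of_mul_eq_one_right (L.coordChange_mul_symm (J 0) (J 1) hx0 hx1)]
    rfl
  -- BOTTOM: `d(-(∂ log h_i)) = (i/2) d((d log h_i) ∘ J) = 2πi • (Chern form)_i`
  have hbot : ∀ (J : Fin 1 → ι), ∀ x ∈ cechSet L.baseSet J,
      (cechd 𝓘(ℝ, E) ℂ L.isOpen_baseSet 0 1 (Z 0 1) J : MForm 𝓘(ℝ, E) M ℂ (1 + 1)) x =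
        ((2 * (Real.pi : ℂ) * Complex.I) • θ) x := by
    intro J x hx
    have hx0 : x ∈ L.baseSet (J 0) := cechSet_subset_apply _ J 0 hx
    rw [cechd_apply, pow_zero, one_smul, localD_apply_of_mem _ _ hx, hZ,
      mextDeriv_restr_apply (isOpen_cechSet L.isOpen_baseSet J) _ hx, mextDeriv_neg, Pi.neg_apply,
      mextDeriv_dPrime_apply (h.eventually_smoothAt_ofFun_logWeight hx0), Pi.smul_apply,
      hθ (J 0) x hx0]
    simp only [HolomorphicLineBundle.HermitianMetric.localChernForm, Pi.smul_apply]
    delta HolomorphicLineBundle.HermitianMetric.logWeight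
    have hπ : (Real.pi : ℂ) ≠ 0 := Complex.ofReal_ne_zero.2 Real.pi_ne_zero
    ext v
    simp only [ContinuousAlternatingMap.neg_apply, ContinuousAlternatingMap.smul_apply, smul_eq_mul,
      Complex.real_smul]
    push_cast
    field_simp
    ring
  exact ⟨Z, htop, fun a b _ hlt ↦ absurd hlt (Nat.not_lt_zero a), hbot⟩

/-! ### Part 2b: weight one on an integration-scaled model -/

/-- **Lefschetz `(1,1)` in symbol form on an integration-scaled Hodge model.** Let `X` be smooth
projective of dimension `n`, `A` a Hodge model whose comparison `A.deRham` is, in every degree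
`k`, `((2πi)^{k/2})⁻¹ •` the complexified integration family `e₀ = (integrationDeRhamIsoFamily _) ⊗ ℂ`,
and `c ∈ H²(X(ℂ); ℂ)` rational of Hodge type `(1,1)`. Then `c` has a weight-one Milnor symbol
cocycle on `A`: an integral multiple `N • c` (`IsRationalClass.exists_nsmul_isIntegralClass`) pulls
back to an integral class in `e₀(H^{1,1})` (`hodgePQ_independent_of_hodgeModel_holds`,
`A.deRham = (2πi)⁻¹ e₀` in degree `2`), which is `e₀[θ]` for the Chern form `θ` of a Hermitian
holomorphic line cocycle `(L, h)` on a finite chart-convex cover (`exists_real_closed_oneOne_rep`,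
`exists_chartConvexCover`, `exists_isChernForm_of_cechIntegral` fed `CechCocycleIntegral_holds`);
the transition cocycle `(g_ij)` is a Milnor symbol `1`-cocycle
(`isMilnorSymbolCocycle_symbolCochain_zero`) transgressing to `2πi • θ`
(`isTransgression_symbolCochain_zero`), and `A.deRham [2πi • θ] = e₀[θ] = N • A^* c`.
[cite: VoisinHodgeI2002, Thm. 7.10 (proof) and Thm. 11.30] -/
theorem hasSymbolCocycle_zero_of_integrationScaled {n : ℕ} {X : Motives.SchemeOver ℂ}
    (hX : Motives.IsSmoothProjective n X) (A : HodgeModel n X)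
    (hA : ∀ (k : ℕ) (y : complexDeRhamCohomology A.model A.carrier k),
      A.deRham A.carrier k y = ((2 * (Real.pi : ℂ) * Complex.I) ^ (k / 2))⁻¹ •
        (integrationDeRhamIsoFamily A.model).complexify A.carrier k y)
    (c : complexBetti X (2 * (0 + 1))) (hc : IsRationalClass c)
    (h11 : IsOfHodgeType n X (2 * (0 + 1)) (0 + 1) (0 + 1) c) : A.HasSymbolCocycle 0 c := by
  haveI : CompactSpace A.carrier := by
    haveI := compactSpace_complexPoints_of_isSmoothProjective hX
    exact A.isAnalytification.homeomorph.symm.compactSpace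
  have hs0 : (2 * (Real.pi : ℂ) * Complex.I) ≠ 0 := Complex.two_pi_I_ne_zero
  -- the comparison in degree `2`: `A.deRham = (2πi)⁻¹ • e₀`
  have h2 : ∀ y : complexDeRhamCohomology A.model A.carrier 2, A.deRham A.carrier 2 y =
      (2 * (Real.pi : ℂ) * Complex.I)⁻¹ •
        (integrationDeRhamIsoFamily A.model).complexify A.carrier 2 y := by
    intro y
    rw [hA 2 y, show (2 / 2 : ℕ) = 1 from rfl, pow_one]
  -- an integral multiple `N • c`, pulled back to `X^an`
  obtain ⟨N, hN, hint⟩ := hc.exists_nsmul_isIntegralClass hX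
  have hβi : IsIntegralClass (A.pullback 2 ((N : ℂ) • c)) :=
    hint.map ⟨A.toComplexPoints, A.isAnalytification.isHomeomorph.continuous⟩
  -- Hodge type `(1,1)` read in the model `A`, then through `e₀ = 2πi • A.deRham`
  have h11A : A.pullback 2 c ∈ A.hodgePQ 2 1 1 :=
    (hodgePQ_independent_of_hodgeModel_holds.isOfHodgeType_iff hX A).1 h11
  obtain ⟨y, hy, hyc⟩ := Submodule.mem_map.1 h11A
  have hyc' : A.deRham A.carrier 2 y = A.pullback 2 c := hyc
  have hey : (integrationDeRhamIsoFamily A.model).complexify A.carrier 2 y =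
      (2 * (Real.pi : ℂ) * Complex.I) • A.pullback 2 c := by
    rw [← hyc', h2, smul_smul, mul_inv_cancel₀ hs0, one_smul]
  have hβ11 : A.pullback 2 ((N : ℂ) • c) ∈ (hodgePQ A.model A.carrier 2 1 1).map
      ((integrationDeRhamIsoFamily A.model).complexify A.carrier 2).toLinearMap := by
    refine Submodule.mem_map.2 ⟨((N : ℂ) * (2 * (Real.pi : ℂ) * Complex.I)⁻¹) • y,
      Submodule.smul_mem _ _ hy, ?_⟩
    change (integrationDeRhamIsoFamily A.model).complexify A.carrier 2
        (((N : ℂ) * (2 * (Real.pi : ℂ) * Complex.I)⁻¹) • y) = A.pullback 2 ((N : ℂ) • c)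
    rw [map_smul, map_smul, hey, smul_smul, mul_assoc, inv_mul_cancel₀ hs0, mul_one]
  -- Step 1 of the heart: a real closed `(1,1)` representative `θ` with `e₀[θ] = A^*(N • c)`
  obtain ⟨θ, hθ, hθt, hθr, hβθ⟩ := exists_real_closed_oneOne_rep _ hβi hβ11
  have hθs : IsSmoothForm θ := ((mem_cclosedSmoothForms_iff θ).1 hθ).1
  have hθc : IsClosedForm θ := ((mem_cclosedSmoothForms_iff θ).1 hθ).2
  -- a finite chart-convex cover, and the Hermitian holomorphic line cocycle with Chern form `θ`
  obtain ⟨s, ⟨𝒰⟩⟩ := exists_chartConvexCover (E := A.model) (M := A.carrier)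
  have hint' : IsIntegralClass ((integrationDeRhamIsoFamily A.model).complexify A.carrier 2
      (complexDeRhamCohomology.mk A.model A.carrier 2 ⟨θ, hθ⟩)) := hβθ ▸ hβi
  obtain ⟨L, h, -, hChern⟩ := exists_isChernForm_of_cechIntegral 𝒰 hθs hθc hθt hθr
    (CechCocycleIntegral_holds A.model A.carrier (↥s) 𝒰 θ hθ hint')
  -- the comparison: `A.deRham [2πi • θ] = e₀[θ] = N • A^* c`
  have hcmp : A.deRham A.carrier 2 (complexDeRhamCohomology.mk A.model A.carrier 2
      ((2 * (Real.pi : ℂ) * Complex.I) • ⟨θ, hθ⟩)) = ((N : ℤ) : ℂ) • A.pullback 2 c := by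
    rw [map_smul, h2, map_smul, smul_smul, inv_mul_cancel₀ hs0, one_smul, ← hβθ, Int.cast_natCast,
      map_smul]
  exact ⟨↥s, inferInstance, L.baseSet, L.isOpen_baseSet, L.exists_mem_baseSet, L.symbolCochain 0,
    L.isMilnorSymbolCocycle_symbolCochain_zero, (2 * (Real.pi : ℂ) * Complex.I) • ⟨θ, hθ⟩, (N : ℤ),
    by exact_mod_cast hN.ne', isTransgression_symbolCochain_zero L h hChern, hcmp⟩

/-! ### The stub -/

/-- **S1 (weight-one model)**: on a smooth projective complex `n`-fold, `n ≥ 1`, there is a Hodge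
model `A` whose comparison is the `(2πi)^{-k/2}`-rescaled integration comparison
(`exists_hodgeModel_integrationScaled`, from `nonempty_hodgeModel_holds`) and on which every
rational class of type `(1,1)` has a weight-one Milnor symbol cocycle
(`hasSymbolCocycle_zero_of_integrationScaled`): Lefschetz `(1,1)` in symbol form.
[cite: VoisinHodgeI2002, Thm. 7.10 (proof) and Thm. 11.30] -/
theorem stub_weightOneModel : ∀ ⦃n : ℕ⦄ ⦃X : Motives.SchemeOver ℂ⦄, Motives.IsSmoothProjective n X → 1 ≤ n → ∃ A : HodgeModel n X, (∀ (k : ℕ) (y : complexDeRhamCohomology A.model A.carrier k), A.deRham A.carrier k y = ((2 * (Real.pi : ℂ) * Complex.I) ^ (k / 2))⁻¹ • (integrationDeRhamIsoFamily A.model).complexify A.carrier k y) ∧ (∀ c : complexBetti X (2 * (0 + 1)), IsRationalClass c → IsOfHodgeType n X (2 * (0 + 1)) (0 + 1) (0 + 1) c → A.HasSymbolCocycle 0 c) := by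
  intro n X hX _
  obtain ⟨A₀⟩ := (nonempty_hodgeModel_holds (n := n) (X := X)).nonempty hX
  obtain ⟨A, hA⟩ := exists_hodgeModel_integrationScaled A₀
  exact ⟨A, hA, fun c hc h11 ↦ hasSymbolCocycle_zero_of_integrationScaled hX A hA c hc h11⟩

end Summit.HodgeConjecture.HodgeConjecture.Theorems.SymbolLiftR
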